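import Mathlib
import HarnessLib
import Summits.ValiantsHypothesis.ValiantsHypothesis.Theses.MonotoneRestoration
import Literature.Computability.AlgebraicComplexity.ArithCircuit
import Literature.Computability.AlgebraicComplexity.ArithCircuitProofs
import Literature.Computability.AlgebraicComplexity.MonotoneStructure
import Literature.Computability.AlgebraicComplexity.PermanentIrreducible
import Literature.ModelTheory.FiniteModelTheory.CkEquiv
import Summits.ValiantsHypothesis.ValiantsHypothesis.Theorems.MonotoneRestorationMonotoneRestorationQPCosetCount
import Summits.ValiantsHypothesis.ValiantsHypothesis.Theorems.MonotoneRestorationMonotoneRestorationQPSymmetricLB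
import Summits.ValiantsHypothesis.ValiantsHypothesis.Theorems.MonotoneRestorationMonotoneRestorationQPSupportSymmetrisation
import Summits.ValiantsHypothesis.ValiantsHypothesis.Theorems.MonotoneRestorationMonotoneRestorationQPSparseRegime
import Summits.ValiantsHypothesis.ValiantsHypothesis.Theorems.MonotoneRestorationMonotoneRestorationQPBeta
import Literature.Computability.AlgebraicComplexity.SymmetricArithCircuit
import Literature.Computability.AlgebraicComplexity.DawarWilsenach2025Proofs
import Literature.GroupTheory.PermutationGroups.SmallIndexSubgroups
import Summits.ValiantsHypothesis.ValiantsHypothesis.Theorems.MonotoneRestorationQP.Negative.LoadBearing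
import Summits.ValiantsHypothesis.ValiantsHypothesis.Theorems.MonotoneRestorationMonotoneRestorationQPPermSupportCount

/-! TTRL-lite variant V19384 of stmt-ValiantsHypothesis-15886 -/

namespace Summit.ValiantsHypothesis.ValiantsHypothesis.Theorems

open Summit.ValiantsHypothesis.ValiantsHypothesis.Theses.MonotoneRestoration
open Literature.Computability.AlgebraicComplexity

/-- TTRL-lite variant V19384 (`lemma_proposal`) of `stub_symmetricMonotone_choose_le_card`
(stmt-ValiantsHypothesis-15886): used gates are homogeneous. If the output polynomial
`f = C.eval (C.output ())` is homogeneous of degree `d` and every monomial `m` of `C.eval g`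
extends by a fixed context monomial `μ` into the support of `f`, then `C.eval g` is
homogeneous of degree `d - deg μ`. Pure degree bookkeeping: write `C.eval g` as the sum of its monomials
(`MvPolynomial.as_sum`); for each `m` in the support, `m + μ ∈ supp f` forces
`deg m + deg μ = d` (`MvPolynomial.IsHomogeneous.coeff_eq_zero`), so `deg m = d - deg μ`
and each monomial is homogeneous of that degree (`MvPolynomial.isHomogeneous_monomial`). -/
theorem stub_symmetricMonotone_choose_le_card_var19384 :
    ∀ (n : ℕ) (G : Type) (C : LabelledArithCircuit NNReal (Fin n × Fin n) Unit G) (d : ℕ) (g : G)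
      (μ : Fin n × Fin n →₀ ℕ), (C.eval (C.output ())).IsHomogeneous d →
      (∀ m ∈ (C.eval g).support, m + μ ∈ (C.eval (C.output ())).support) →
      (C.eval g).IsHomogeneous (d - μ.degree) := by
  intro n G C d g μ hhom hext
  rw [MvPolynomial.as_sum (C.eval g)]
  refine MvPolynomial.IsHomogeneous.sum _ _ _ (fun m hm => ?_)
  apply MvPolynomial.isHomogeneous_monomial
  have hsupp : m + μ ∈ (C.eval (C.output ())).support := hext m hm
  have hdeg : (m + μ).degree = d := by
    by_contra hne
    exact (MvPolynomial.mem_support_iff.mp hsupp) (hhom.coeff_eq_zero hne)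
  rw [map_add] at hdeg
  omega

end Summit.ValiantsHypothesis.ValiantsHypothesis.Theorems
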